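import Summits.BirchSwinnertonDyer.BirchSwinnertonDyer.Theorems.ByReductionTypeAtTwoRankOneAtTwoOneDoorLawFirstLayerDefs
import Summits.BirchSwinnertonDyer.BirchSwinnertonDyer.Theorems.ByReductionTypeAtTwoRankOneAtTwoBigImageOddLocalOneDoorSubslicePosDisc
import Summits.BirchSwinnertonDyer.BirchSwinnertonDyer.Theorems.ByReductionTypeAtTwoRankOneAtTwoBigImageOddLocalOneDoorSubsliceNegDisc
import Summits.BirchSwinnertonDyer.BirchSwinnertonDyer.Theorems.ByReductionTypeAtTwoRankOneAtTwoBigImageOddLocalOneDoorEggKappaDictionary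
import Summits.BirchSwinnertonDyer.BirchSwinnertonDyer.Theorems.GenusKolyvaginAtTwoGenusPrimitiveSupplyAtTwoArchimedeanRowsHold
import Literature.NumberTheory.EllipticCurves.HeegnerPointReflectionHolds
import Literature.NumberTheory.EllipticCurves.LeadingTermHeegnerProofs
import Literature.NumberTheory.EllipticCurves.StrictSelmerRankOne
import HarnessLib

/-!
# Route ByReductionTypeAtTwo, crux `RankOneAtTwoBigImageOddLocal` (stmt-BirchSwinnertonDyer-23715), LINE v8.17 `one_door_analytic`:
# AN-13 ON THE SLICE IS A COROLLARY OF THE REGISTERED FIRST-LAYER STUB — Kolyvagin's conjecture at `2` puts the Heegner point on the egg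

Lead prover seat `bsd-line-fkl-p1` g16 (2026-08-29), `--supports stmt-BirchSwinnertonDyer-23715` (helper).  THEOREMS ONLY; no definition, no named fact
introduced, no `sorry`; conditional by design where the registered residue R₀⁺ / R₀ and the PRINT facts are hypotheses.  BSD is not proved by any of this.

Skeleton v8.17 replaced -an's AN-13 `F1Sign2.HeegnerPointOnEggAtTwo` (Heegner point rational-on-the-EGG up to torsion at every desc-admissible door of a rank-one
`Ш[2] = 0` egg curve) by the sign-free first-layer stub R₀⁺ `HeegnerExponentAtSelmerTrivialMinimalDoorAtTwo`.  `…FirstLayerCone.lean` proved R₀ ⟸ R⁻₀ ∧ AN-13; this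
file proves the converse reading on the slice: **R₀⁺ ⟹ AN-13 restricted to the slice** — so on the crux's curves -an's archimedean conjecture IS Kolyvagin's
conjecture at `2`.  Three steps, each a tree assembly:
* §1 **the Heegner point of an analytic-rank-one curve is RATIONAL UP TO TORSION** (`exists_incl_sub_mem_torsion_of_isHeegnerPoint`): the sign of the functional
  equation is `−1` (modularity, `even_analyticRank_iff_rootNumber_eq_one`), so complex conjugation fixes `P_K` up to torsion (Darmon 2004 Prop. 3.11 — the tree's
  PROVED reflection theorem `heegnerPoint_conj_add_rootNumber_smul_holds`); with `E(K)[2] = 0` the torsion defect `t = σP − P` is uniquely halved, `t = 2t₁`,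
  `σ t₁ = −t₁`, and `R := P + t₁` is `σ`-fixed, hence comes from `E(ℚ)` (Galois descent `QuadraticDescent.exists_incl_eq_of_conjMap_eq`);
* §2 **exponent `0` + `E(ℚ)` meets the egg ⟹ on the egg up to torsion** for a Heegner point (`eggUpToTorsion_of_heegner_exponent_zero`): transport to the rational
  point `R` of §1 and apply the width seat fkl-p2 g14's AN-34n dictionary `eggUpToTorsion_iff_meetsEgg_and_exponent_zero` (`E(ℚ) = ℤg + tors` from
  `exists_generator_of_mordellWeilRank_eq_one`);
* §3 **`heegnerPointOnEgg_slice_of_heegnerNonDivisibilityMinimalDoor`** / **`…_of_heegnerExponent`**: R₀ (resp. R₀⁺) + Gross–Zagier + Kolyvagin + modularity +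
  Hoffstein–Luo ⟹ for every `W` of the slice with `Δ_W > 0`, `Ш(W)[2] = 0`, `MeetsEgg W`, every imaginary quadratic `K` with `d_K` desc-admissible, every
  odd-constant datum, the Heegner point is on the egg up to torsion — AN-13's conclusion, its door made `Sel₂`-trivial by the PROVED egg twist law.

References: [Darmon2004] Prop. 3.11, §3.9; [Gross1984] §5; [Zhang2014CJM] Thm. 1.1 (shape); [Kramer1981] Prop. 6; [GrossZagier1986] Thm. I.6.3, V.§2;
[SilvermanAEC2009] X.2 Prop. 2.4 (Galois descent), VIII (Mordell–Weil).
-/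

set_option autoImplicit false
-- the Theorems namespace of this sub repeats the summit name by design (D-0017 nested layout)
set_option linter.dupNamespace false

noncomputable section

open scoped Classical

namespace Summit.BirchSwinnertonDyer.BirchSwinnertonDyer.Theorems.RankOneAtTwoOneDoor

open WeierstrassCurve NumberField Literature.NumberTheory.EllipticCurves Literature.NumberTheory.EllipticCurves.ModularForms
  Summit.BirchSwinnertonDyer.Rank1Residual.F1Sign2
  Summit.BirchSwinnertonDyer.Rank1Residual.F1Sign2.TranspositionDoor
  Summit.BirchSwinnertonDyer.BirchSwinnertonDyer.Theses.ByReductionTypeAtTwo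
open WeierstrassCurve.QuadraticDescent (incl conjMap conjMap_conjMap exists_incl_eq_of_conjMap_eq)
open Summit.BirchSwinnertonDyer.BirchSwinnertonDyer.Theorems.GenusKolyArch (eggTwistLawAtTwo_holds)

/-! ### §1 The Heegner point of an analytic-rank-one curve is rational up to torsion -/

/-- **An imaginary quadratic field has a non-trivial `ℚ`-endomorphism** (complex conjugation: `K = ℚ(θ)`, `θ² = c`, `θ ↦ −θ`;
`Quadratic.conj`, and `θ ≠ 0` as `θ ∉ ℚ`). [folklore] -/
theorem exists_algHom_ne_id_of_isImaginaryQuadratic (K : Type) [Field K] [NumberField K] (hK : IsImaginaryQuadratic K) :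
    ∃ σ : K →ₐ[ℚ] K, σ ≠ AlgHom.id ℚ K := by
  obtain ⟨θ, c, hθ, hc⟩ := Literature.NumberTheory.QuadraticFields.Quadratic.exists_sq_eq_algebraMap (F := ℚ) (K := K) hK.1
  refine ⟨Literature.NumberTheory.QuadraticFields.Quadratic.conj hK.1 hθ hc, fun hid => ?_⟩
  have hθθ : (Literature.NumberTheory.QuadraticFields.Quadratic.conj hK.1 hθ hc) θ = -θ :=
    Literature.NumberTheory.QuadraticFields.Quadratic.conj_gen hK.1 hθ hc
  rw [hid, AlgHom.id_apply] at hθθ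
  have h0 : θ = 0 := by
    have h2 : θ + θ = 0 := by rw [eq_neg_iff_add_eq_zero.mp hθθ]
    exact add_self_eq_zero.mp h2
  exact hθ ⟨0, by rw [h0, map_zero]⟩

/-- **THE HEEGNER POINT OF AN ANALYTIC-RANK-ONE CURVE IS RATIONAL UP TO TORSION**: for `W/ℚ` globally minimal of analytic rank `1` (modularity: the sign of
the functional equation is `−1`), `K` imaginary quadratic with the Heegner hypothesis and `E(K)[2] = 0`, and `P ∈ E(K)` a Heegner point of level `N_W`, there is a
RATIONAL point `R` with `P − ι R` torsion.  Proof: complex conjugation `σ` satisfies `σP − P = t` torsion (Darmon 2004 Prop. 3.11, tree theorem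
`heegnerPoint_conj_add_rootNumber_smul_holds` at sign `−1`); `t = 2t₁` (`E(K)[2] = 0`: `EggDoubling.torsion_eq_two_smul'`) with `σt₁ = −t₁` (halves are unique
and `σt = −t`); `R := P + t₁` is `σ`-fixed, so `R = ι R₀` (`QuadraticDescent.exists_incl_eq_of_conjMap_eq`), and `P − ι R₀ = −t₁` is torsion.
[cite: Darmon2004, Prop. 3.11 and §3.9] [cite: Gross1984, §5] [cite: SilvermanAEC2009, X.2 Prop. 2.4] -/
theorem exists_incl_sub_mem_torsion_of_isHeegnerPoint (hnf : exists_isNewformOf)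
    (W : WeierstrassCurve ℚ) [W.IsElliptic] [W.IsGloballyMinimal] [NeZero (W.conductorNorm ℤ)] (hr : W.analyticRank = 1)
    (K : Type) [Field K] [NumberField K] (hK : IsImaginaryQuadratic K) (hHN : SatisfiesHeegnerHypothesis (W.conductorNorm ℤ) K)
    (hT2K : ∀ Q : (W.baseChange K).toAffine.Point, 2 • Q = 0 → Q = 0)
    (P : (W.baseChange K).toAffine.Point) (hP : IsHeegnerPoint (W.conductorNorm ℤ) W K P) :
    ∃ R : W.toAffine.Point, P - incl K W R ∈ AddCommGroup.torsion (W.baseChange K).toAffine.Point := by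
  -- the sign of the functional equation is `-1`
  have hw : W.rootNumber = -1 := by
    have hiff : Even W.analyticRank ↔ W.rootNumber = 1 := even_analyticRank_iff_rootNumber_eq_one_of_exists_isNewformOf W hnf
    rcases rootNumber_eq_one_or_eq_neg_one W with h1 | h1
    · exfalso
      have hev : Even W.analyticRank := hiff.mpr h1
      rw [hr] at hev
      exact Nat.not_even_one hev
    · exact h1
  -- complex conjugation and the torsion defect `t = σP - P`
  obtain ⟨σ, hσ⟩ := exists_algHom_ne_id_of_isImaginaryQuadratic K hK
  have hσσ : ∀ z, σ (σ z) = z := Literature.NumberTheory.EllipticCurves.Quadratic.apply_apply_of_ne_id hK.1 hσ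
  have ht : IsOfFinAddOrder (conjMap W σ P - P) :=
    heegnerPoint_conj_add_rootNumber_smul.sub_isOfFinAddOrder heegnerPoint_conj_add_rootNumber_smul_holds hK hHN hP hσ hw
  set t : (W.baseChange K).toAffine.Point := conjMap W σ P - P with ht_def
  have hσt : conjMap W σ t = -t := by
    rw [ht_def, map_sub, conjMap_conjMap W hσσ, neg_sub]
  -- halve the defect: `t = 2 • t₁` with `σ t₁ = -t₁`
  obtain ⟨t₁, ht₁⟩ := EggDoubling.torsion_eq_two_smul' hT2K t ((AddCommGroup.mem_torsion _).mpr ht)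
  have hσt₁ : conjMap W σ t₁ = -t₁ := by
    have h2 : 2 • (conjMap W σ t₁ + t₁) = 0 := by
      rw [smul_add, ← map_nsmul, ← ht₁, hσt, neg_add_cancel]
    exact eq_neg_of_add_eq_zero_left (hT2K _ h2)
  -- `R := P + t₁` is `σ`-fixed, hence rational
  have hfix : conjMap W σ (P + t₁) = P + t₁ := by
    have hσP : conjMap W σ P = P + t := by rw [ht_def]; abel
    rw [map_add, hσP, hσt₁, ht₁]
    abel
  obtain ⟨R, hR⟩ := exists_incl_eq_of_conjMap_eq hK.1 W hσ hfix
  refine ⟨R, ?_⟩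
  -- `P - ι R = -t₁` is torsion (`2 • t₁ = t` is)
  have ht₁tor : t₁ ∈ AddCommGroup.torsion (W.baseChange K).toAffine.Point := by
    rw [AddCommGroup.mem_torsion]
    obtain ⟨k, hk, hkt⟩ := (isOfFinAddOrder_iff_nsmul_eq_zero).mp ht
    refine (isOfFinAddOrder_iff_nsmul_eq_zero).mpr ⟨k * 2, Nat.mul_pos hk two_pos, ?_⟩
    rw [mul_nsmul', ← ht₁]
    exact hkt
  have hPR : P - incl K W R = -t₁ := by rw [hR]; abel
  rw [hPR]
  exact (AddCommGroup.torsion (W.baseChange K).toAffine.Point).neg_mem ht₁tor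

/-! ### §2 Exponent `0` and `E(ℚ)` meeting the egg put a Heegner point on the egg up to torsion -/

/-- **A HEEGNER POINT OF EXPONENT `0` ON A RANK-ONE EGG CURVE IS ON THE EGG UP TO TORSION.**  `W/ℚ` globally minimal elliptic, `Δ_W > 0`, `E(ℚ)[2] = 0`,
`rank E(ℚ) = 1`, `E(ℚ)` meets the egg, analytic rank `1` (modularity, for the sign); `K` imaginary quadratic with the Heegner hypothesis; `P ∈ E(K)` a Heegner
point with `HasTwoDivisibilityUpToTorsion W K P 0`.  THEN `EggUpToTorsion W K P`.  By §1 `P = ι R + (torsion)` with `R` rational; `R ≠ O` (else `P` would be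
torsion, impossible at exponent `0`); exponent `0` and egg-ness are invariant under torsion translation, and for the rational point `R` the width seat's AN-34n
dictionary `eggUpToTorsion_iff_meetsEgg_and_exponent_zero` applies (`E(ℚ) = ℤg + tors` by `exists_generator_of_mordellWeilRank_eq_one`, `E(K)[2] = 0` by
`EggDoubling.eq_zero_of_two_smul_eq_zero_baseChange`).  CONDITIONAL on `exists_isNewformOf`; BSD is not proved by this. [cite: Darmon2004, Prop. 3.11]
[cite: Kramer1981, Prop. 6] [cite: SilvermanAEC2009, X.2 Prop. 2.4] -/
theorem eggUpToTorsion_of_heegner_exponent_zero (hnf : exists_isNewformOf)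
    (W : WeierstrassCurve ℚ) [W.IsElliptic] [W.IsGloballyMinimal] [NeZero (W.conductorNorm ℤ)] (hr : W.analyticRank = 1)
    (hΔ : 0 < W.Δ) (hT : NoRationalTwoTorsion W) (hrk : W.mordellWeilRank = 1) (hmeets : MeetsEgg W)
    (K : Type) [Field K] [NumberField K] (hK : IsImaginaryQuadratic K) (hHN : SatisfiesHeegnerHypothesis (W.conductorNorm ℤ) K)
    (P : (W.baseChange K).toAffine.Point) (hP : IsHeegnerPoint (W.conductorNorm ℤ) W K P) (hm0 : HasTwoDivisibilityUpToTorsion W K P 0) :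
    EggUpToTorsion W K P := by
  have hT2K : ∀ Q : (W.baseChange K).toAffine.Point, 2 • Q = 0 → Q = 0 := EggDoubling.eq_zero_of_two_smul_eq_zero_baseChange W hT hK.1
  obtain ⟨R, hR⟩ := exists_incl_sub_mem_torsion_of_isHeegnerPoint hnf W hr K hK hHN hT2K P hP
  -- `E(ℚ) = ℤg + tors`
  have hcyc : ∃ g : W.toAffine.Point, ∀ Q : W.toAffine.Point, ∃ k : ℤ, Q - k • g ∈ AddCommGroup.torsion W.toAffine.Point := by
    obtain ⟨g, -, hgen⟩ := exists_generator_of_mordellWeilRank_eq_one W hrk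
    -- the generator lemma is stated with the classical `DecidableEq ℚ` inside the group law of `E(ℚ)`; the instance is a subsingleton
    have hI : (fun a b : ℚ => Classical.propDecidable (a = b)) = instDecidableEqRat := Subsingleton.elim _ _
    rw [hI] at hgen
    refine ⟨g, fun Q => ?_⟩
    obtain ⟨a, t, htor, hQ⟩ := hgen Q
    refine ⟨a, ?_⟩
    have e : Q - a • g = t := by rw [hQ]; abel
    rw [e]
    exact (AddCommGroup.mem_torsion _).mpr htor
  -- exponent `0` passes to `ι R`
  have hm0R : HasTwoDivisibilityUpToTorsion W K (incl K W R) 0 := by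
    obtain ⟨Q, hPQ, hQ⟩ := hm0
    refine ⟨Q, ?_, hQ⟩
    have e : incl K W R - 2 ^ 0 • Q = (P - 2 ^ 0 • Q) - (P - incl K W R) := by abel
    rw [e]
    exact (AddCommGroup.torsion (W.baseChange K).toAffine.Point).sub_mem hPQ hR
  -- `R` is an affine rational point (not `O`: `P` has infinite order)
  rcases R with _ | ⟨x, y, hxy⟩
  · exfalso
    have h0 : incl K W (WeierstrassCurve.Affine.Point.zero : W.toAffine.Point) = 0 := rfl
    rw [h0, sub_zero] at hR
    exact not_isOfFinAddOrder_of_hasTwoDivisibilityUpToTorsion_zero W K P hm0 ((AddCommGroup.mem_torsion _).mp hR)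
  · have hKns : (W.baseChange K).toAffine.Nonsingular (algebraMap ℚ K x) (algebraMap ℚ K y) :=
      (WeierstrassCurve.Affine.map_nonsingular (W := W.toAffine) (algebraMap ℚ K).injective x y).mpr hxy
    have hι : incl K W (WeierstrassCurve.Affine.Point.some x y hxy) = WeierstrassCurve.Affine.Point.some _ _ hKns := rfl
    rw [hι] at hR hm0R
    -- the AN-34n dictionary at the rational point
    have hegg : EggUpToTorsion W K (WeierstrassCurve.Affine.Point.some _ _ hKns) :=
      (eggUpToTorsion_iff_meetsEgg_and_exponent_zero W hΔ hT hcyc K hK x y hKns).mpr ⟨hmeets, hm0R⟩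
    -- transport back to `P` along the torsion translation
    obtain ⟨x', y', h', hon, htor⟩ := hegg
    refine ⟨x', y', h', hon, ?_⟩
    have e : P - WeierstrassCurve.Affine.Point.some _ _ h' =
        (P - WeierstrassCurve.Affine.Point.some _ _ hKns) + (WeierstrassCurve.Affine.Point.some _ _ hKns - WeierstrassCurve.Affine.Point.some _ _ h') := by
      abel
    rw [e]
    exact (AddCommGroup.torsion (W.baseChange K).toAffine.Point).add_mem hR htor

/-! ### §3 AN-13 on the slice from the registered first-layer stub -/

/-- **R₀ ⟹ AN-13 ON THE SLICE**: under `HeegnerNonDivisibilityAtSelmerTrivialMinimalDoorAtTwo` (the odd-constant face of the registered stub R₀⁺) and the four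
primary printed facts, every curve of the slice (`W` globally minimal, non-CM, `ρ_{W,2^n}` onto, odd torsion order, odd Tamagawa product, analytic rank `1`) with
`Δ_W > 0`, `Ш(W)[2] = 0` and `E(ℚ)` meeting the egg has, at every imaginary quadratic `K` with `d_K` DESC-admissible and every ODD-constant datum, its Heegner point
ON THE EGG up to torsion — the conclusion of -an's AN-13 `F1Sign2.HeegnerPointOnEggAtTwo` on the slice.  The door is door-admissible and minimal
(`ANg16.doorAdmissible_of_descAdmissible`, `minimal_of_descAdmissible_of_pos`), Heegner and coprime to `N_W` (`satisfiesHeegnerHypothesis_of_doorAdmissible`,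
`GenusKoly.heegner_isCoprime_conductorNorm_discr`), and `Sel₂`-trivial by the PROVED egg twist law; R₀ gives exponent `0`; §2 gives the egg.  With
`…FirstLayerCone.lean` (AN-13 ∧ R⁻₀ ⟹ R₀): on the slice AN-13 and the `Δ_W > 0` face of R₀ are EQUIVALENT modulo print.  CONDITIONAL by design; BSD is not
proved by this. [cite: Zhang2014CJM, Thm. 1.1 (shape)] [cite: Kramer1981, Prop. 6] [cite: Darmon2004, Prop. 3.11] [cite: GrossZagier1986, Thm. I.6.3 and V.§2] -/
theorem heegnerPointOnEgg_slice_of_heegnerNonDivisibilityMinimalDoor (h : HeegnerNonDivisibilityAtSelmerTrivialMinimalDoorAtTwo)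
    (hGZ : ∀ (N : ℕ) [NeZero N] (W : WeierstrassCurve ℚ) (K : Type) [Field K] [NumberField K], gross_zagier N W K)
    (hKo : ∀ (N : ℕ) [NeZero N] (W : WeierstrassCurve ℚ) (K : Type) [Field K] [NumberField K], kolyvagin N W K)
    (hnf : exists_isNewformOf) (hHL : HoffsteinLuo1997_exists_twist_L_one_ne_zero)
    (W : WeierstrassCurve ℚ) [W.IsElliptic] [W.IsGloballyMinimal] [NeZero (W.conductorNorm ℤ)]
    (hCM : ¬ W.HasCM) (hsurj : ∀ n : ℕ, W.HasSurjectiveModNGaloisRep ((2 ^ n : ℕ) : ℤ)) (hT : Odd W.torsionOrder)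
    (hc : Odd W.tamagawaProduct) (hr : W.analyticRank = 1) (hΔ : 0 < W.Δ) (hSha : ShaTwoTrivial W) (hmeets : MeetsEgg W)
    (K : Type) [Field K] [NumberField K] (hK : IsImaginaryQuadratic K) (hDA : DescAdmissible W (NumberField.discr K))
    (Dt : ModularParametrizationData W (W.conductorNorm ℤ)) (H : HeegnerDatum (W.conductorNorm ℤ) (NumberField.discr K)) (ι : K →+* ℂ)
    (P : (W.baseChange K).toAffine.Point) (hP : WeierstrassCurve.Affine.Point.map ι.toRatAlgHom P = heegnerPointComplex Dt H) (hodd : Odd Dt.c) :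
    EggUpToTorsion W K P := by
  have hT2 : NoRationalTwoTorsion W := noRationalTwoTorsion_of_odd_torsionOrder W hT
  have hrk : W.mordellWeilRank = 1 := (mordellWeilRank_eq_one_of_analyticRank_eq_one_of_isGloballyMinimal hGZ hKo hnf hHL W hr).1
  have hadm : DoorAdmissible W (NumberField.discr K) := ANg16.doorAdmissible_of_descAdmissible W hDA
  have hmin : transpCount W (NumberField.discr K) + 2 * identCount W (NumberField.discr K) = (if W.Δ < 0 then 1 else 0) :=
    minimal_of_descAdmissible_of_pos W hΔ hDA
  have hHN : SatisfiesHeegnerHypothesis (W.conductorNorm ℤ) K := satisfiesHeegnerHypothesis_of_doorAdmissible W K hK hadm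
  have hcop : Nat.Coprime (NumberField.discr K).natAbs (W.conductorNorm ℤ) := by
    have h1 := Summit.BirchSwinnertonDyer.BirchSwinnertonDyer.Theorems.GenusKoly.heegner_isCoprime_conductorNorm_discr (W := W) hK hHN
    have h2 := Int.isCoprime_iff_gcd_eq_one.mp h1
    rw [Int.gcd_eq_natAbs, Int.natAbs_natCast] at h2
    exact Nat.Coprime.symm h2
  have hsel : twistSelmerTwoCard W (NumberField.discr K) = 1 := (eggTwistLawAtTwo_holds W hΔ hT2 hrk hSha (NumberField.discr K) hDA).1 hmeets
  have hm0 : HasTwoDivisibilityUpToTorsion W K P 0 := h W hCM hsurj hT hc hr hSha K hK hadm hmin hcop hHN hsel Dt H ι P hP hodd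
  exact eggUpToTorsion_of_heegner_exponent_zero hnf W hr hΔ hT2 hrk hmeets K hK hHN P ⟨Dt, H, ι, hP⟩ hm0

/-- **R₀⁺ ⟹ AN-13 ON THE SLICE** (the registered stub `stub_heegnerExponent`'s statement, through its odd-constant face
`heegnerNonDivisibilityMinimalDoor_of_heegnerExponent`).  CONDITIONAL by design; BSD is not proved by this. [cite: Zhang2014CJM, Thm. 1.1 (shape)]
[cite: Kramer1981, Prop. 6] [cite: Darmon2004, Prop. 3.11] -/
theorem heegnerPointOnEgg_slice_of_heegnerExponent (h : HeegnerExponentAtSelmerTrivialMinimalDoorAtTwo)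
    (hGZ : ∀ (N : ℕ) [NeZero N] (W : WeierstrassCurve ℚ) (K : Type) [Field K] [NumberField K], gross_zagier N W K)
    (hKo : ∀ (N : ℕ) [NeZero N] (W : WeierstrassCurve ℚ) (K : Type) [Field K] [NumberField K], kolyvagin N W K)
    (hnf : exists_isNewformOf) (hHL : HoffsteinLuo1997_exists_twist_L_one_ne_zero)
    (W : WeierstrassCurve ℚ) [W.IsElliptic] [W.IsGloballyMinimal] [NeZero (W.conductorNorm ℤ)]
    (hCM : ¬ W.HasCM) (hsurj : ∀ n : ℕ, W.HasSurjectiveModNGaloisRep ((2 ^ n : ℕ) : ℤ)) (hT : Odd W.torsionOrder)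
    (hc : Odd W.tamagawaProduct) (hr : W.analyticRank = 1) (hΔ : 0 < W.Δ) (hSha : ShaTwoTrivial W) (hmeets : MeetsEgg W)
    (K : Type) [Field K] [NumberField K] (hK : IsImaginaryQuadratic K) (hDA : DescAdmissible W (NumberField.discr K))
    (Dt : ModularParametrizationData W (W.conductorNorm ℤ)) (H : HeegnerDatum (W.conductorNorm ℤ) (NumberField.discr K)) (ι : K →+* ℂ)
    (P : (W.baseChange K).toAffine.Point) (hP : WeierstrassCurve.Affine.Point.map ι.toRatAlgHom P = heegnerPointComplex Dt H) (hodd : Odd Dt.c) :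
    EggUpToTorsion W K P :=
  heegnerPointOnEgg_slice_of_heegnerNonDivisibilityMinimalDoor (heegnerNonDivisibilityMinimalDoor_of_heegnerExponent h) hGZ hKo hnf hHL W hCM hsurj
    hT hc hr hΔ hSha hmeets K hK hDA Dt H ι P hP hodd

end Summit.BirchSwinnertonDyer.BirchSwinnertonDyer.Theorems.RankOneAtTwoOneDoor

end
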